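import Literature.MathematicalPhysics.QuantumFieldTheory.Balaban1983to89.T4Covariance

/-!
# Block averaging versus axis reflections — kernel certificates for the convention hazard O-COV1-1

Registry path: `Literature/MathematicalPhysics/QuantumFieldTheory/Balaban1983to89/AveragingReflection.lean`.
Cell `pub-balaban`, unit b2b-balaban-pv18 (T4-DAG v1 row T4-RP2c.L, Setup-level part; objection O-COV1-1 of
`t4/T4-XREAD-COV1.md`, GAPS G-t4-COV1-3).  STATUS: bookkeeping (label arithmetic + one group-theoretic counter-example); no
estimate; no statement is minted — everything below is kernel-proved about the cell's OWN typed conventions (`Setup.blockOf`,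
`Setup.emb`, `Setup.Averaging`, `Site.reflect` of module `TorusHypercubicSymmetry`, `GaugeField.creflect` of module `T4Covariance`).

## What is certified — the two claims stated in prose in the module docstring of `T4Covariance` (unit pv26-g2)

B12 = [Balaban1987RG1] T. Bałaban, Renormalization group approach to lattice gauge field theories. I, CMP 109 (1987) 249–301,
p. 269 (2.17): «Now consider a Euclidean symmetry r of the torus T, preserving the torus T^{(k+1)}. …».  In the cell's labels (B12
(0.1) p. 251: sites = CENTRES of cubes, the origin a cube CORNER at every scale; `blockOf` = `⌊·/L⌋`, `emb y = yL + (L-1)/2`, `L`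
odd) the reflections of the `ρ`-axis preserving the block structure `T^{(j)} → T^{(j+1)}` are `n_ρ ↦ C - n_ρ` with
`C ≡ -1 (mod L)`; the level-uniform representative is the CENTRE reflection `n_ρ ↦ -n_ρ - 1` (`GaugeField.creflect`, module
`T4Covariance`).  The tree's `Site.reflect ρ` (`n_ρ ↦ -n_ρ`, `C = 0`) used SIMULTANEOUSLY at both levels is not such a pair:

* `Averaging.not_reflect_equivariant` (§2) — the claim «contradicts `Averaging.covariant` for non-trivial `G`»: for EVERY
  `av : Averaging P j G` in the standing range `j + 1 ≤ m + K` and every gauge group with an element `g ≠ 1`, the naive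
  equivariance `∀ U, av.avg (U.reflect ρ) = (av.avg U).reflect ρ` is FALSE — it contradicts the covariance axiom (B7 (11))
  already for a δ-gauge transformation at one site.  Hence a named hypothesis of that shape is unsatisfiable and every theorem
  under it vacuous (objection O-COV1-1; independently located by unit t4-lean-g2, CLAIMS.log 2026-08-18T18:49:40Z); the landed
  `T4Continuum.FiniteEpsData.AvgReflEquivariant` (module `T4Covariance`) uses `creflect` instead and is inhabited
  (`AveragingRT.axialAvg_creflect`).
* `blockOf_creflect` (§3) — the claim «`blockOf (-x-1) = -blockOf x - 1`»: the centre reflection of the fine labels maps the block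
  of `y` onto the block of the centre reflection of `y` (standing range); together with `Site.emb_creflect` of module
  `T4Covariance` (`emb (-y-1) = -emb y - 1`) this is the full compatibility of `creflect` with the block geometry (`blockOf`, `emb`) that enters
  `Averaging.covariant` and `Averaging.local_dep`.
* `GaugeField.reflect_gaugeAct` (§1): reflections intertwine gauge transformations, `(U^u).reflect ρ = (U.reflect ρ)^{u ∘ r_ρ}`
  (folklore; the algebra behind §2).

Value = kernel certificate of a located typing objection + block-label arithmetic, NOT summit progress.

REVISION LOG.  v1 p178576 (unit b2b-balaban-pv18, 2026-08-18).  v1.1 (DOCFIX, docstring-only, NO declaration touched; unit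
b2b-balaban-pv12 gen 4, T4-DAG v2 row T4-DOCFIX-2, 2026-08-18): the B12 (2.17) p. 269 quotation read «T_ζ» at two places (module
docstring above; docstring of `Averaging.not_reflect_equivariant`) — print is «Now consider a Euclidean symmetry r of the torus T,
preserving the torus T^{(k+1)}. We define generally» (italic T followed by a comma; render
`b2b-balaban-ref1/pages/1987-cmp109-rg-I-small-field/1987-cmp109-rg-I-small-field-p021-x2.png` read as an image by the cross-reader
of GAPS C-pv01-15 (c) and again by this unit); both corrected to «T,».
-/

namespace Literature.MathematicalPhysics.QuantumFieldTheory.Balaban1983to89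

variable {P : Params} {j : ℕ} {G : Type*} [GaugeGroup G]

/-! ## 1. Reflections intertwine gauge transformations -/

namespace GaugeField

/-- `(U^u)(r_ρ b)` read through the reflection: `(U^u).reflect ρ = (U.reflect ρ)^{u ∘ r_ρ}` — on a `ρ`-bond the reflected bond is
traversed backwards, which exchanges the roles of source and target exactly as the inverse does. [folklore] -/
theorem reflect_gaugeAct (ρ : Fin P.d) (u : GaugeTransf P j G) (U : GaugeField P j G) :
    (gaugeAct u U).reflect ρ = gaugeAct (fun x => u (x.reflect ρ)) (U.reflect ρ) := by
  funext b
  by_cases h : b.dir = ρ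
  · have hs : (b.reflect ρ).src = b.tgt.reflect ρ := by
      simp only [PBond.reflect_src_of_eq ρ b h, PBond.tgt, h]
    have ht : (b.reflect ρ).tgt = b.src.reflect ρ := by
      simp only [PBond.tgt, PBond.reflect_dir, h, PBond.reflect_src_of_eq ρ b h, Site.shift_reflect_shift]
    simp only [gaugeAct, reflect_apply, if_pos h, hs, ht, mul_inv_rev, inv_inv, mul_assoc]
  · have hs : (b.reflect ρ).src = b.src.reflect ρ := PBond.reflect_src_of_ne ρ b h
    have ht : (b.reflect ρ).tgt = b.tgt.reflect ρ := by
      simp only [PBond.tgt, PBond.reflect_dir, hs]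
      rw [Site.shift_reflect_of_ne ρ b.src h]
    simp only [gaugeAct, reflect_apply, if_neg h, hs, ht]

end GaugeField

/-! ## 2. The naive two-level reflection equivariance contradicts gauge covariance (certificate of O-COV1-1) -/

namespace AveragingReflection

/-- `L - 1 = 2·((L-1)/2)` for the odd block size `L`. [folklore] -/
lemma pred_L_eq_two_mul_half (P : Params) : P.L - 1 = 2 * ((P.L - 1) / 2) := by
  obtain ⟨k, hk⟩ := P.hL.1; omega

/-- The same identity between residues. [folklore] -/
lemma natCast_pred_L (P : Params) (n : ℕ) : ((P.L - 1 : ℕ) : ZMod n) = 2 * (((P.L - 1) / 2 : ℕ) : ZMod n) := by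
  conv_lhs => rw [pred_L_eq_two_mul_half P]
  rw [Nat.cast_mul, Nat.cast_ofNat]

/-- In the standing range the fine site count is `L` times the coarse one, hence at least `2L`. [cite: Balaban1987RG1, (0.1) p.251] -/
lemma two_mul_L_le_sitesPerDir (hj : j + 1 ≤ P.m + P.K) : 2 * P.L ≤ P.sitesPerDir j := by
  rw [P.sitesPerDir_eq_mul_succ hj]
  exact Nat.mul_le_mul_right P.L (P.one_lt_sitesPerDir (j + 1))

/-- `val (-a - 1) = N - 1 - val a` in `ℤ/N`: the centre reflection of the labels `0, …, N-1` is `v ↦ N - 1 - v`, with no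
wrap-around. [folklore] -/
lemma val_neg_sub_one {N : ℕ} [NeZero N] (a : ZMod N) : (-a - 1).val = N - 1 - a.val := by
  have hv : a.val < N := ZMod.val_lt a
  have hc : ((a.val : ℕ) : ZMod N) = a := ZMod.natCast_zmod_val a
  have h1 : ((N - 1 - a.val : ℕ) : ZMod N) + a + 1 = 0 := by
    rw [Nat.sub_sub, Nat.cast_sub (by omega : 1 + a.val ≤ N), ZMod.natCast_self, Nat.cast_add, Nat.cast_one, zero_sub]
    linear_combination -hc
  have h2 : (-a - 1 : ZMod N) = ((N - 1 - a.val : ℕ) : ZMod N) := by linear_combination -h1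
  rw [h2, ZMod.val_natCast, Nat.mod_eq_of_lt (by omega)]

end AveragingReflection

namespace Averaging

open AveragingReflection

/-- KERNEL CERTIFICATE of objection O-COV1-1 (GAPS G-t4-COV1-3; asserted in prose in the module docstring of `T4Covariance`).  For
every one-step averaging operation of the cell's interface (`Setup.Averaging`: gauge covariance B7 (11) with the centred inclusion
`emb`, B12 (0.1)/(0.3)) in the standing range, and every gauge group possessing an element `g ≠ 1`, the NAIVE reflection
equivariance — the tree's `reflect ρ` (`n_ρ ↦ -n_ρ`) applied at BOTH levels — fails for some configuration.  Proof: `reflect`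
intertwines gauge actions (§1); with covariance used twice one gets `W^{u ∘ r ∘ emb} = W^{u ∘ emb ∘ r}` for all gauge
transformations `u`, `W = (avg 1).reflect ρ`; but `r (emb 0)` and `emb (r 0)` differ by `L - 1 ≠ 0` in the `ρ`-coordinate, so the
δ-gauge transformation `u = g` at the single site `r (emb 0)` evaluated on the coarse bond `⟨0, ρ⟩` forces `g = 1`.  Consequently a
hypothesis `∀ K j ρ U, (av K j).avg (U.reflect ρ) = ((av K j).avg U).reflect ρ` is unsatisfiable for `SU(N)`, `N ≥ 2`: the
block-compatible reflections are the CENTRED ones (§3, `GaugeField.creflect` of module `T4Covariance`, and B12 (2.17) p. 269 «a Euclidean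
symmetry r of the torus T, preserving the torus T^{(k+1)}»). [cite: Balaban1987RG1, (2.17) p.269] -/
theorem not_reflect_equivariant (hj : j + 1 ≤ P.m + P.K) (av : Averaging P j G) (ρ : Fin P.d)
    (hG : ∃ g : G, g ≠ 1) :
    ¬ ∀ U : GaugeField P j G, av.avg (U.reflect ρ) = (av.avg U).reflect ρ := by
  intro H
  obtain ⟨g, hg⟩ := hG
  -- the site carrying the δ-gauge transformation: the naive reflection of the centre of the block of `0`
  set z₀ : Site P j := (emb (0 : Site P (j + 1))).reflect ρ with hz₀
  let u : GaugeTransf P j G := fun x => if x = z₀ then g else 1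
  -- covariance + naive equivariance, read two ways
  have key : GaugeField.gaugeAct (fun y => u ((emb y).reflect ρ)) ((av.avg 1).reflect ρ)
      = GaugeField.gaugeAct (fun y => u (emb (y.reflect ρ))) ((av.avg 1).reflect ρ) := by
    have e1 := H (GaugeField.gaugeAct u 1)
    rw [av.covariant hj, GaugeField.reflect_gaugeAct, GaugeField.reflect_gaugeAct, av.covariant hj, H 1] at e1
    exact e1
  have hc := congrFun key ⟨0, ρ⟩
  simp only [GaugeField.gaugeAct, PBond.tgt] at hc
  -- arithmetic of the four sites in the `ρ`-coordinate
  have hL := P.hL.2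
  have h2L := two_mul_L_le_sitesPerDir hj
  have hhalf := pred_L_eq_two_mul_half P
  have hNL := P.sitesPerDir_eq_mul_succ hj
  -- a positive natural number below the modulus is a non-zero residue
  have ncast : ∀ a : ℕ, 0 < a → a < P.sitesPerDir j → ((a : ℕ) : ZMod (P.sitesPerDir j)) ≠ 0 := by
    intro a h0 h e
    have h1 := congrArg ZMod.val e
    rw [ZMod.val_natCast, Nat.mod_eq_of_lt h, ZMod.val_zero] at h1
    omega
  have cz : z₀ ρ = -((((P.L - 1) / 2 : ℕ)) : ZMod (P.sitesPerDir j)) := by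
    rw [hz₀, Site.reflect_apply, if_pos rfl, Site.emb_apply_eq, Site.zero_apply, map_zero, zero_add]
  -- (i) the naive reflection of the centre of the block of `e_ρ`
  have ne1 : (emb ((0 : Site P (j + 1)).shift ρ)).reflect ρ ≠ z₀ := by
    intro e
    have e' := congrFun e ρ
    rw [Site.reflect_apply, if_pos rfl, Site.emb_apply_eq, Site.shift_apply, if_pos rfl, cz, Site.zero_apply, zero_add,
      Site.scaleCoord_one] at e'
    have hL0 : ((P.L : ℕ) : ZMod (P.sitesPerDir j)) = 0 := by linear_combination -e'
    exact ncast _ (by omega) (by omega) hL0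
  -- (ii) the centre of the block of `r 0 = 0`
  have ne2 : emb ((0 : Site P (j + 1)).reflect ρ) ≠ z₀ := by
    intro e
    have e' := congrFun e ρ
    rw [Site.emb_apply_eq, Site.reflect_apply, if_pos rfl, cz, Site.zero_apply, neg_zero, map_zero, zero_add] at e'
    have h2 : ((P.L - 1 : ℕ) : ZMod (P.sitesPerDir j)) = 0 := by
      rw [natCast_pred_L]; linear_combination e'
    exact ncast _ (by omega) (by omega) h2
  -- (iii) the centre of the block of `r e_ρ = -e_ρ`
  have ne3 : emb (((0 : Site P (j + 1)).shift ρ).reflect ρ) ≠ z₀ := by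
    intro e
    have e' := congrFun e ρ
    rw [Site.emb_apply_eq, Site.scaleCoord_apply, cz] at e'
    have hvN : ((((0 : Site P (j + 1)).shift ρ).reflect ρ) ρ).val + 1 ≤ P.sitesPerDir (j + 1) := ZMod.val_lt _
    set v : ℕ := ((((0 : Site P (j + 1)).shift ρ).reflect ρ) ρ).val with hv
    have h3 : ((v * P.L + (P.L - 1) : ℕ) : ZMod (P.sitesPerDir j)) = 0 := by
      rw [Nat.cast_add, natCast_pred_L]
      linear_combination e'
    refine ncast _ (by omega) ?_ h3
    have hle := Nat.mul_le_mul_right P.L hvN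
    rw [add_mul, one_mul, ← hNL] at hle
    omega
  -- evaluate the δ-gauge transformation at the four sites
  have u0 : u z₀ = g := if_pos rfl
  have u1 : u ((emb ((0 : Site P (j + 1)).shift ρ)).reflect ρ) = 1 := if_neg ne1
  have u2 : u (emb ((0 : Site P (j + 1)).reflect ρ)) = 1 := if_neg ne2
  have u3 : u (emb (((0 : Site P (j + 1)).shift ρ).reflect ρ)) = 1 := if_neg ne3
  rw [← hz₀, u0, u1, u2, u3, inv_one, mul_one, mul_one] at hc
  exact hg (mul_right_cancel hc)

/-- The same certificate for a whole family of averagings (the shape of a `FiniteEpsData.av K`): the naive two-level reflection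
equivariance at EVERY level is refuted at the level `j = 0` as soon as `1 ≤ m + K` (the series has `m ≥ 1`; `Params` does not
record it, so it is a hypothesis here). [folklore] -/
theorem not_reflect_equivariant_family (hmK : 1 ≤ P.m + P.K) (av : ∀ j, Averaging P j G) (ρ : Fin P.d)
    (hG : ∃ g : G, g ≠ 1) :
    ¬ ∀ (j : ℕ) (U : GaugeField P j G), (av j).avg (U.reflect ρ) = ((av j).avg U).reflect ρ := by
  intro H
  have h0 : 0 + 1 ≤ P.m + P.K := by omega
  exact not_reflect_equivariant h0 (av 0) ρ hG (H 0)

end Averaging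

/-! ## 3. The compatible pair: the centre reflection `n_ρ ↦ -n_ρ - 1` at both levels preserves the blocks -/

section Partner

open AveragingReflection

/-- KERNEL PROOF of the claim «`blockOf (-x-1) = -blockOf x - 1`» (module docstring of `T4Covariance`): the CENTRE reflection
`n_ρ ↦ -n_ρ - 1` of the fine labels (the site map underlying `GaugeField.creflect ρ`) maps the block `B(y)` onto the block
`B(-y-1)` of the centre-reflected coarse site — for `n = qL + s`, `0 ≤ s < L`: `N_j - 1 - n = (N_{j+1} - 1 - q)L + (L-1-s)`
(standing range, `N_j = N_{j+1}·L`).  Companion of `Site.emb_creflect` of module `T4Covariance` (`emb (-y-1) = -emb y - 1`): together they say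
that `creflect` is a «Euclidean symmetry … preserving the torus T^{(k+1)}» of B12 (2.17) in the cell's typed block geometry
(B12 (0.1)/(0.3) pp. 251–252), whereas the site reflection `n_ρ ↦ -n_ρ` is not (§2). [cite: Balaban1987RG1, (0.3) p.252] -/
theorem blockOf_creflect (hj : j + 1 ≤ P.m + P.K) (x : Site P j) (ρ : Fin P.d) :
    blockOf ((x.reflect ρ).unshift ρ) = ((blockOf x).reflect ρ).unshift ρ := by
  have hL := P.hL.2
  have hNL := P.sitesPerDir_eq_mul_succ hj
  funext μ
  by_cases hμ : μ = ρ
  · subst hμ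
    -- Euclidean division of the label by `L`
    obtain ⟨q, s, hs, hqs⟩ : ∃ q s : ℕ, s < P.L ∧ (x μ).val = P.L * q + s :=
      ⟨(x μ).val / P.L, (x μ).val % P.L, Nat.mod_lt _ P.L_pos, (Nat.div_add_mod _ P.L).symm⟩
    have hvn : (x μ).val < P.sitesPerDir j := ZMod.val_lt _
    have hq : (x μ).val / P.L = q := by
      rw [hqs, Nat.mul_add_div P.L_pos, Nat.div_eq_of_lt hs, add_zero]
    have hqN : q < P.sitesPerDir (j + 1) := by
      rw [← hq, Nat.div_lt_iff_lt_mul P.L_pos, ← hNL]; exact hvn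
    apply ZMod.val_injective
    rw [Site.val_blockOf hj, Site.unshift_apply (x.reflect μ) μ μ, if_pos rfl, Site.reflect_apply μ x μ, if_pos rfl,
      val_neg_sub_one, Site.unshift_apply ((blockOf x).reflect μ) μ μ, if_pos rfl, Site.reflect_apply μ (blockOf x) μ,
      if_pos rfl, val_neg_sub_one, Site.val_blockOf hj, hq]
    -- `(N_j - 1 - (qL + s)) / L = N_{j+1} - 1 - q`
    obtain ⟨M, hM⟩ : ∃ M, P.sitesPerDir (j + 1) = q + M + 1 := ⟨P.sitesPerDir (j + 1) - q - 1, by omega⟩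
    have hprod : P.sitesPerDir j = P.L * q + P.L * M + P.L := by rw [hNL, hM]; ring
    have himg : P.sitesPerDir j - 1 - (x μ).val = P.L * M + (P.L - 1 - s) := by omega
    rw [himg, Nat.mul_add_div P.L_pos, Nat.div_eq_of_lt (by omega), add_zero]
    omega
  · simp only [blockOf, Site.unshift_apply, Site.reflect_apply, if_neg hμ]

/-- Corollary: the block of the centre-reflected block centre is the centre-reflected coarse site (`blockOf ∘ emb = id` transported
through the compatible pair). [cite: Balaban1987RG1, (0.3) p.252] -/
theorem blockOf_creflect_emb (hj : j + 1 ≤ P.m + P.K) (y : Site P (j + 1)) (ρ : Fin P.d) :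
    blockOf (((emb y).reflect ρ).unshift ρ) = (y.reflect ρ).unshift ρ := by
  rw [← Site.emb_creflect, Site.blockOf_emb hj]

/-- The compatible pair in the block-membership form used by `Averaging.local_dep`: `x` lies in the block of `y` iff the
centre-reflected `x` lies in the block of the centre-reflected `y` (standing range). [cite: Balaban1987RG1, (0.3) p.252] -/
theorem blockOf_creflect_eq_iff (hj : j + 1 ≤ P.m + P.K) (x : Site P j) (y : Site P (j + 1)) (ρ : Fin P.d) :
    blockOf ((x.reflect ρ).unshift ρ) = (y.reflect ρ).unshift ρ ↔ blockOf x = y := by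
  rw [blockOf_creflect hj]
  constructor
  · intro h
    have h' := congrArg (fun z : Site P (j + 1) => (z.shift ρ).reflect ρ) h
    simpa only [Site.shift_unshift, Site.reflect_reflect] using h'
  · intro h; rw [h]

end Partner

end Literature.MathematicalPhysics.QuantumFieldTheory.Balaban1983to89
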